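import Literature.Barriers.CriticalPhenomena.WeaklySAWPerturbativeCoefficients
import Literature.Barriers.CriticalPhenomena.WeaklySAWPerturbativeBetaMassDecay
import HarnessLib

/-!
# BBS-rg-pt, Lemma 6.1.2 for `η_j` and `θ_j` of the weakly self-avoiding walk (`d = 4`):
# `|η_j|, |θ_j| ≤ K_L(1+L^{2j}m²/(8+m²))^{-p}` (so `= O(χ_j)`), and `≤ K_L` for all `m² ≥ 0`

Companion of `WeaklySAWPerturbativeCoefficients.lean` (the coefficients `η_j = 2L^{2(j+1)}C_{j+1;0,0}`,
`θ_j = 2δ[(w³)^{(**)}]` of the quadratic flow `φ̄` of Bauerschmidt–Brydges–Slade, CMP 337 (2015)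
[BBS2015], §6.1, on the explicit decomposition) and of `WeaklySAWPerturbativeBetaMassDecay.lean` (the
scaling estimate with mass decay `|C_{j+1;0,x}| ≤ c(1+L^{2j}m²/(8+m²))^{-p}/L^{2j}` and the same
counting for `β_j`). Source of the estimates: R. Bauerschmidt, D. C. Brydges, G. Slade,
*A renormalisation group method. III. Perturbative analysis*, J. Stat. Phys. **159** (2015),
arXiv:1403.7252 [BBS-rg-pt], Lemma 6.1.2 ("`β_j, θ_j, σ_j, ζ_j = O(L^{-(d-4)j}(1+m²L^{2j})^{-k})`,
`η'_j, π'_j, ξ'_j = O(L^{-(d-2)j}(1+m²L^{2j})^{-k})` … with constants which may depend on `L`") and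
its proof ("Bound on `θ_j`. By definition, `θ_j` is proportional to `δ[(w³)^{(**)}] = 3(w²C)^{(**)} +
3(wC²)^{(**)} + (C³)^{(**)}` …"), which [BBS2015] §6.1 quotes as "In [BBS-rg-pt], it is verified that
the coefficients `θ_j, η_j, ξ_j, π_j` are bounded by `O(χ_j)`" (Assumption (A2)).

## What this file proves (everything; no definition, no named fact), `d = 4`, `L ≥ 2`

* `abs_etaPT_le`, `abs_etaPT_le_decay` — `|η_j| ≤ 2cL²` (`m² ≥ 0`) and `|η_j| ≤ 2cL²ϑ_j` (`m² > 0`),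
  `ϑ_j = (1+L^{2j}m²/(8+m²))^{-p}`;
* counting lemmas: `sq_coords_le_l1_sq` (`|x|₂² ≤ |x|₁²`), `sum_ind_mul_ind_le`
  (`Σ_x𝟙_k𝟙_l ≤ 16L⁴L^{2k}L^{2l}`), `abs_thetaPT_le_core` (the bound in terms of ANY sup bound `A`
  on `C_{j+1}`: `|θ_j| ≤ L⁶(6c²t + 6ct² + 2t³)`, `t = AL^{2j}`);
* **`abs_thetaPT_le`**, **`abs_thetaPT_le_decay`** — `|θ_j| ≤ 14c³L⁶` for all `m² ≥ 0`, `j`, and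
  `|θ_j| ≤ K L⁶ϑ_j` for `m² > 0` (every `p`).
-/

noncomputable section

open Set Filter Topology
open Literature.Probability.LatticeModels
open scoped BigOperators

namespace Literature.Barriers.CriticalPhenomena

namespace CTWSAW

open LongRangePhi4 LongRangePhi4.FRD PT

/-! ### `η_j` -/

/-- **`|η_j| ≤ 2cL²`** for all `m² ≥ 0`, `j` (`|C_{j+1;0,0}| ≤ c/L^{2j}`).
[cite: BauerschmidtBrydgesSlade2015LogCorr, §6.1 (Assumption (A2) for η_j; [BBS-rg-pt] Lemma 6.1.2)] -/
theorem abs_etaPT_le : ∃ C : ℝ, 0 < C ∧ ∀ L : ℝ, 2 ≤ L → ∀ s : ℝ, 0 ≤ s → ∀ j : ℕ,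
    |etaPT 4 L s j| ≤ C * L ^ 2 := by
  obtain ⟨c, hc, h⟩ := abs_Gam_four_le
  refine ⟨2 * c, by positivity, fun L hL s hs j => ?_⟩
  have hL0 : (0 : ℝ) < L := by linarith
  have hG := h L hL s hs j 0
  unfold etaPT etaPrimePT
  rw [abs_mul, abs_mul, abs_of_pos (pow_pos hL0 _), abs_two]
  have e : L ^ (2 * (j + 1)) = L ^ 2 * L ^ (2 * j) := by ring
  rw [e]
  have hp : 0 < L ^ (2 * j) := pow_pos hL0 _
  calc L ^ 2 * L ^ (2 * j) * (2 * |Gam 4 L s (j + 1) 0|) ≤ L ^ 2 * L ^ (2 * j) * (2 * (c / L ^ (2 * j))) := by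
        gcongr
    _ = 2 * c * L ^ 2 := by field_simp

/-- **`|η_j| ≤ 2cL²(1+L^{2j}m²/(8+m²))^{-p}`** for `m² > 0` (every `p`): `η_j = O(χ_j)`.
[cite: BauerschmidtBrydgesSlade2015LogCorr, §6.1 (Assumption (A2): η_j = O(χ_j); [BBS-rg-pt] Lemma 6.1.2)] -/
theorem abs_etaPT_le_decay (p : ℕ) : ∃ C : ℝ, 0 < C ∧ ∀ L : ℝ, 2 ≤ L → ∀ s : ℝ, 0 < s → ∀ j : ℕ,
    |etaPT 4 L s j| ≤ C * L ^ 2 * ((1 + L ^ (2 * j) * s / (8 + s)) ^ p)⁻¹ := by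
  obtain ⟨c, hc, h⟩ := abs_Gam_four_le_decay p
  refine ⟨2 * c, by positivity, fun L hL s hs j => ?_⟩
  have hL0 : (0 : ℝ) < L := by linarith
  have hG := h L hL s hs j 0
  set ϑ : ℝ := ((1 + L ^ (2 * j) * s / (8 + s)) ^ p)⁻¹
  unfold etaPT etaPrimePT
  rw [abs_mul, abs_mul, abs_of_pos (pow_pos hL0 _), abs_two]
  have e : L ^ (2 * (j + 1)) = L ^ 2 * L ^ (2 * j) := by ring
  rw [e]
  have hp : 0 < L ^ (2 * j) := pow_pos hL0 _
  calc L ^ 2 * L ^ (2 * j) * (2 * |Gam 4 L s (j + 1) 0|) ≤ L ^ 2 * L ^ (2 * j) * (2 * (c * ϑ / L ^ (2 * j))) := by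
        gcongr
    _ = 2 * c * L ^ 2 * ϑ := by field_simp

/-! ### Counting lemmas -/

/-- `|x|₂² ≤ |x|₁²`. [folklore] -/
theorem sq_coords_le_l1_sq {d : ℕ} (x : Site d) :
    (∑ i, ((x i : ℤ) : ℝ) ^ 2) ≤ (((∑ i, (x i).natAbs : ℕ) : ℝ)) ^ 2 := by
  have hcast : (((∑ i, (x i).natAbs : ℕ) : ℝ)) = ∑ i, |((x i : ℤ) : ℝ)| := by
    push_cast
    refine Finset.sum_congr rfl fun i _ => ?_
    rw [Nat.cast_natAbs, Int.cast_abs]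
  rw [hcast, sq, Finset.sum_mul]
  refine Finset.sum_le_sum fun i _ => ?_
  rw [sq, ← abs_mul_abs_self]
  exact mul_le_mul_of_nonneg_left
    (Finset.single_le_sum (f := fun k => |((x k : ℤ) : ℝ)|) (fun k _ => abs_nonneg _) (Finset.mem_univ i))
    (abs_nonneg _)

/-- **`Σ_x𝟙_k(x)𝟙_l(x) ≤ 16L⁴L^{2k}L^{2l}`** (the smaller ball: `min(L^{4k},L^{4l}) ≤ L^{2k}L^{2l}`).
[cite: BauerschmidtBrydgesSlade2015LogCorr, §6.1 ([BBS-rg-pt] Lemma 6.1.2, proof: volume factors)] -/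
theorem sum_ind_mul_ind_le (S : Finset (Site 4)) {L : ℝ} (hL : 1 ≤ L) (k l : ℕ) :
    ∑ x ∈ S, (if x ∈ PT.ball (L ^ (k + 1) / 2) then (1 : ℝ) else 0) *
        (if x ∈ PT.ball (L ^ (l + 1) / 2) then (1 : ℝ) else 0) ≤ 16 * L ^ 4 * L ^ (2 * k) * L ^ (2 * l) := by
  have h1 : ∀ i x, (0 : ℝ) ≤ (if x ∈ PT.ball (d := 4) (L ^ (i + 1) / 2) then (1 : ℝ) else 0) ∧
      (if x ∈ PT.ball (d := 4) (L ^ (i + 1) / 2) then (1 : ℝ) else 0) ≤ 1 := fun i x => by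
    split_ifs <;> norm_num
  rcases le_or_gt k l with hkl | hkl
  · calc ∑ x ∈ S, (if x ∈ PT.ball (L ^ (k + 1) / 2) then (1 : ℝ) else 0) *
          (if x ∈ PT.ball (L ^ (l + 1) / 2) then (1 : ℝ) else 0)
        ≤ ∑ x ∈ S, (if x ∈ PT.ball (L ^ (k + 1) / 2) then (1 : ℝ) else 0) :=
          Finset.sum_le_sum fun x _ => mul_le_of_le_one_right (h1 k x).1 (h1 l x).2
      _ ≤ 16 * L ^ 4 * L ^ (4 * k) := sum_ball_indicator_le S hL k
      _ ≤ 16 * L ^ 4 * L ^ (2 * k) * L ^ (2 * l) := by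
          rw [mul_assoc (16 * L ^ 4), ← pow_add]
          exact mul_le_mul_of_nonneg_left (pow_le_pow_right₀ hL (by omega)) (by positivity)
  · calc ∑ x ∈ S, (if x ∈ PT.ball (L ^ (k + 1) / 2) then (1 : ℝ) else 0) *
          (if x ∈ PT.ball (L ^ (l + 1) / 2) then (1 : ℝ) else 0)
        ≤ ∑ x ∈ S, (if x ∈ PT.ball (L ^ (l + 1) / 2) then (1 : ℝ) else 0) :=
          Finset.sum_le_sum fun x _ => mul_le_of_le_one_left (h1 l x).1 (h1 k x).2
      _ ≤ 16 * L ^ 4 * L ^ (4 * l) := sum_ball_indicator_le S hL l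
      _ ≤ 16 * L ^ 4 * L ^ (2 * k) * L ^ (2 * l) := by
          rw [mul_assoc (16 * L ^ 4), ← pow_add]
          exact mul_le_mul_of_nonneg_left (pow_le_pow_right₀ hL (by omega)) (by positivity)

/-- `Σ_x|x|₁²𝟙_k(x) ≤ 4L⁶L^{6k}` (`|x|₁ < ½L^{k+1}` on the ball, `16L⁴L^{4k}` points).
[cite: BauerschmidtBrydgesSlade2015LogCorr, §6.1 ([BBS-rg-pt] Lemma 6.1.2, proof: bound on w^{(**)})] -/
theorem sum_l1_sq_ind_le (S : Finset (Site 4)) {L : ℝ} (hL : 1 ≤ L) (k : ℕ) :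
    ∑ x ∈ S, (((∑ i, (x i).natAbs : ℕ) : ℝ)) ^ 2 * (if x ∈ PT.ball (L ^ (k + 1) / 2) then (1 : ℝ) else 0) ≤
      4 * L ^ 6 * L ^ (6 * k) := by
  have hpt : ∀ x : Site 4, (((∑ i, (x i).natAbs : ℕ) : ℝ)) ^ 2 *
      (if x ∈ PT.ball (L ^ (k + 1) / 2) then (1 : ℝ) else 0) ≤
      (L ^ (k + 1) / 2) ^ 2 * (if x ∈ PT.ball (L ^ (k + 1) / 2) then (1 : ℝ) else 0) := by
    intro x
    split_ifs with hx
    · rw [PT.mem_ball] at hx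
      have h0 : (0 : ℝ) ≤ ((∑ i, (x i).natAbs : ℕ) : ℝ) := by positivity
      nlinarith
    · simp
  refine (Finset.sum_le_sum fun x _ => hpt x).trans ?_
  rw [← Finset.mul_sum]
  calc (L ^ (k + 1) / 2) ^ 2 * ∑ x ∈ S, (if x ∈ PT.ball (L ^ (k + 1) / 2) then (1 : ℝ) else 0)
      ≤ (L ^ (k + 1) / 2) ^ 2 * (16 * L ^ 4 * L ^ (4 * k)) :=
        mul_le_mul_of_nonneg_left (sum_ball_indicator_le S hL k) (by positivity)
    _ = 4 * L ^ 6 * L ^ (6 * k) := by ring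

/-! ### `θ_j` -/

/-- **The core bound on `θ_j = 2δ[(w³)^{(**)}]`** (`d = 4`, `L ≥ 2`, `m² = s ≥ 0`): if
`|C_{j+1;0,x}| ≤ A` for all `x`, then with `t = AL^{2j}`,
`|θ_j| ≤ L⁶(6c²t + 6ct² + 2t³)` — from `δ[(w³)] = C(3w² + 3wC + C²)`, `|x|₂² ≤ |x|₁²`,
`|w_j| ≤ Σ_{k<j}(c/L^{2k})𝟙_k`, `|x|₁²𝟙_k𝟙_l ≤ R_kR_l𝟙_k𝟙_l` (`R_k = ½L^{k+1}`),
`Σ_x𝟙_k𝟙_l ≤ 16L⁴L^{2k}L^{2l}`, `Σ_x|x|₁²𝟙_k ≤ 4L⁶L^{6k}`, `Σ_{k<j}Lᵏ ≤ Lʲ`, `Σ_{k<j}L^{4k} ≤ L^{4j}`.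
[cite: BauerschmidtBrydgesSlade2015LogCorr, §6.1 ([BBS-rg-pt] Lemma 6.1.2, proof: "Bound on θ_j")] -/
theorem abs_thetaPT_le_core {c : ℝ} (hc0 : 0 < c)
    (hc : ∀ L : ℝ, 2 ≤ L → ∀ s : ℝ, 0 ≤ s → ∀ i : ℕ, ∀ x : Site 4, |Gam 4 L s (i + 1) x| ≤ c / L ^ (2 * i))
    {L : ℝ} (hL : 2 ≤ L) {s : ℝ} (hs : 0 ≤ s) (j : ℕ) {A : ℝ} (hA0 : 0 ≤ A)
    (hA : ∀ x : Site 4, |Gam 4 L s (j + 1) x| ≤ A) :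
    |thetaPT 4 L s j| ≤ L ^ 6 * (6 * c ^ 2 * (A * L ^ (2 * j)) + 6 * c * (A * L ^ (2 * j)) ^ 2 +
      2 * (A * L ^ (2 * j)) ^ 3) := by
  classical
  have hL1 : (1 : ℝ) ≤ L := by linarith
  have hL0 : (0 : ℝ) < L := by linarith
  set S : Finset (Site 4) := PT.ball (L ^ (j + 1) / 2) with hSdef
  set a : ℕ → ℝ := fun i => c / L ^ (2 * i) with ha
  set R : ℕ → ℝ := fun i => L ^ (i + 1) / 2 with hR
  set ind : ℕ → Site 4 → ℝ := fun i x => if x ∈ PT.ball (L ^ (i + 1) / 2) then (1 : ℝ) else 0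
    with hind
  set n1 : Site 4 → ℝ := fun x => (((∑ i, (x i).natAbs : ℕ) : ℝ)) with hn1
  have ha0 : ∀ i, 0 ≤ a i := fun i => by simp only [ha]; positivity
  have hR0 : ∀ i, 0 ≤ R i := fun i => by simp only [hR]; positivity
  have hind0 : ∀ i x, 0 ≤ ind i x := fun i x => by simp only [hind]; split_ifs <;> norm_num
  have hind1 : ∀ i x, ind i x ≤ 1 := fun i x => by simp only [hind]; split_ifs <;> norm_num
  have hn10 : ∀ x, 0 ≤ n1 x := fun x => by simp only [hn1]; positivity
  -- support: both `w_{j+1}³` and `w_j³` vanish off `S`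
  have hsupp : ∀ i ≤ j + 1, ∀ x ∉ S, covSum 4 L s i x ^ 3 = 0 := by
    intro i hi x hx
    rw [hSdef, PT.mem_ball, not_lt] at hx
    have hpow : L ^ i / 2 ≤ L ^ (j + 1) / 2 :=
      div_le_div_of_nonneg_right (pow_le_pow_right₀ hL1 hi) (by norm_num)
    rw [covSum_eq_zero (by norm_num) hL1 hs (hpow.trans hx), zero_pow three_ne_zero]
  -- `θ_j` as one finite sum
  have hθ : thetaPT 4 L s j = 1 / 2 * ∑ x ∈ S, (∑ i, ((x i : ℤ) : ℝ) ^ 2) *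
      (covSum 4 L s (j + 1) x ^ 3 - covSum 4 L s j x ^ 3) := by
    unfold thetaPT
    rw [starSum_eq_sum (hsupp (j + 1) le_rfl), starSum_eq_sum (hsupp j (Nat.le_succ j)),
      ← sub_div, ← Finset.sum_sub_distrib]
    simp only [← mul_sub]
    norm_num
    ring
  -- pointwise bounds
  have hW : ∀ x, |covSum 4 L s j x| ≤ ∑ k ∈ Finset.range j, a k * ind k x := fun x =>
    abs_covSum_four_le hc hL hs j x
  have hW0 : ∀ x, 0 ≤ ∑ k ∈ Finset.range j, a k * ind k x := fun x =>
    Finset.sum_nonneg fun k _ => mul_nonneg (ha0 k) (hind0 k x)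
  -- `|x|₁² 𝟙_k 𝟙_l ≤ R_k R_l 𝟙_k 𝟙_l` and `|x|₁² 𝟙_j-ball ≤ R_j²`
  have hRind : ∀ k l x, n1 x ^ 2 * (ind k x * ind l x) ≤ R k * R l * (ind k x * ind l x) := by
    intro k l x
    simp only [hind]
    split_ifs with hk hl
    · rw [PT.mem_ball] at hk hl
      have h0 := hn10 x
      simp only [hn1, hR] at h0 hk hl ⊢
      nlinarith
    all_goals simp
  -- the three sums
  -- T1: `Σ_x |x|₁² |C| w² ≤ A · 4c²L⁶ L^{2j}`
  have hT1 : ∑ x ∈ S, n1 x ^ 2 * (|Gam 4 L s (j + 1) x| * covSum 4 L s j x ^ 2) ≤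
      A * (4 * c ^ 2 * L ^ 6 * L ^ (2 * j)) := by
    have hpt : ∀ x ∈ S, n1 x ^ 2 * (|Gam 4 L s (j + 1) x| * covSum 4 L s j x ^ 2) ≤
        A * ∑ k ∈ Finset.range j, ∑ l ∈ Finset.range j, a k * a l * (R k * R l * (ind k x * ind l x)) := by
      intro x _
      have hsq : covSum 4 L s j x ^ 2 ≤ (∑ k ∈ Finset.range j, a k * ind k x) ^ 2 := by
        rw [← sq_abs]
        exact pow_le_pow_left₀ (abs_nonneg _) (hW x) 2
      have hexp : n1 x ^ 2 * (∑ k ∈ Finset.range j, a k * ind k x) ^ 2 ≤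
          ∑ k ∈ Finset.range j, ∑ l ∈ Finset.range j, a k * a l * (R k * R l * (ind k x * ind l x)) := by
        rw [sq (∑ k ∈ Finset.range j, a k * ind k x), Finset.sum_mul_sum, Finset.mul_sum]
        refine Finset.sum_le_sum fun k _ => ?_
        rw [Finset.mul_sum]
        refine Finset.sum_le_sum fun l _ => ?_
        have := hRind k l x
        have hkl : 0 ≤ a k * a l := mul_nonneg (ha0 k) (ha0 l)
        calc n1 x ^ 2 * (a k * ind k x * (a l * ind l x)) = a k * a l * (n1 x ^ 2 * (ind k x * ind l x)) := by ring
          _ ≤ a k * a l * (R k * R l * (ind k x * ind l x)) := mul_le_mul_of_nonneg_left this hkl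
      calc n1 x ^ 2 * (|Gam 4 L s (j + 1) x| * covSum 4 L s j x ^ 2)
          = |Gam 4 L s (j + 1) x| * (n1 x ^ 2 * covSum 4 L s j x ^ 2) := by ring
        _ ≤ A * (n1 x ^ 2 * (∑ k ∈ Finset.range j, a k * ind k x) ^ 2) :=
            mul_le_mul (hA x) (mul_le_mul_of_nonneg_left hsq (sq_nonneg _)) (by positivity) hA0
        _ ≤ A * ∑ k ∈ Finset.range j, ∑ l ∈ Finset.range j, a k * a l * (R k * R l * (ind k x * ind l x)) :=
            mul_le_mul_of_nonneg_left hexp hA0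
    refine (Finset.sum_le_sum hpt).trans ?_
    rw [← Finset.mul_sum]
    refine mul_le_mul_of_nonneg_left ?_ hA0
    -- now `Σ_k Σ_l a_k a_l R_k R_l Σ_x 𝟙_k𝟙_l ≤ Σ_k Σ_l a_k a_l R_k R_l 16L⁴L^{2k}L^{2l} = 16L⁴ (Σ_k a_kR_kL^{2k})²`
    have hin : ∀ k l, ∑ x ∈ S, a k * a l * (R k * R l * (ind k x * ind l x)) ≤
        16 * L ^ 4 * (a k * R k * L ^ (2 * k)) * (a l * R l * L ^ (2 * l)) := by
      intro k l
      rw [← Finset.mul_sum, ← Finset.mul_sum]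
      have := sum_ind_mul_ind_le S hL1 k l
      have h0 : 0 ≤ a k * a l * (R k * R l) := by positivity
      calc a k * a l * (R k * R l * ∑ x ∈ S, ind k x * ind l x)
          = a k * a l * (R k * R l) * ∑ x ∈ S, ind k x * ind l x := by ring
        _ ≤ a k * a l * (R k * R l) * (16 * L ^ 4 * L ^ (2 * k) * L ^ (2 * l)) :=
            mul_le_mul_of_nonneg_left this h0
        _ = 16 * L ^ 4 * (a k * R k * L ^ (2 * k)) * (a l * R l * L ^ (2 * l)) := by ring
    have hakR : ∀ k, a k * R k * L ^ (2 * k) = c * L / 2 * L ^ k := by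
      intro k
      simp only [ha, hR]
      rw [show 2 * k = k + k by ring, pow_add, pow_succ]
      field_simp
    calc ∑ x ∈ S, ∑ k ∈ Finset.range j, ∑ l ∈ Finset.range j, a k * a l * (R k * R l * (ind k x * ind l x))
        = ∑ k ∈ Finset.range j, ∑ l ∈ Finset.range j, ∑ x ∈ S, a k * a l * (R k * R l * (ind k x * ind l x)) := by
          rw [Finset.sum_comm]
          exact Finset.sum_congr rfl fun k _ => Finset.sum_comm
      _ ≤ ∑ k ∈ Finset.range j, ∑ l ∈ Finset.range j,
            16 * L ^ 4 * (a k * R k * L ^ (2 * k)) * (a l * R l * L ^ (2 * l)) :=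
          Finset.sum_le_sum fun k _ => Finset.sum_le_sum fun l _ => hin k l
      _ = 16 * L ^ 4 * (c * L / 2) ^ 2 * (∑ k ∈ Finset.range j, L ^ k) ^ 2 := by
          simp_rw [hakR]
          rw [sq (∑ k ∈ Finset.range j, L ^ k), Finset.sum_mul_sum]
          rw [Finset.mul_sum]
          refine Finset.sum_congr rfl fun k _ => ?_
          rw [Finset.mul_sum]
          refine Finset.sum_congr rfl fun l _ => ?_
          ring
      _ ≤ 16 * L ^ 4 * (c * L / 2) ^ 2 * (L ^ j) ^ 2 := by
          have hg := geom_sum_le_pow hL j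
          have hg0 : 0 ≤ ∑ k ∈ Finset.range j, L ^ k := Finset.sum_nonneg fun k _ => by positivity
          exact mul_le_mul_of_nonneg_left (pow_le_pow_left₀ hg0 hg 2) (by positivity)
      _ = 4 * c ^ 2 * L ^ 6 * L ^ (2 * j) := by ring
  have e64 : ∀ k : ℕ, L ^ (6 * k) / L ^ (2 * k) = L ^ (4 * k) := fun k => by
    rw [div_eq_iff (pow_ne_zero _ hL0.ne'), ← pow_add]
    ring_nf
  -- T2: `Σ_x |x|₁² |w| C² ≤ A² · 4cL⁶L^{4j}`
  have hT2 : ∑ x ∈ S, n1 x ^ 2 * (|covSum 4 L s j x| * Gam 4 L s (j + 1) x ^ 2) ≤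
      A ^ 2 * (4 * c * L ^ 6 * L ^ (4 * j)) := by
    have hpt : ∀ x ∈ S, n1 x ^ 2 * (|covSum 4 L s j x| * Gam 4 L s (j + 1) x ^ 2) ≤
        A ^ 2 * ∑ k ∈ Finset.range j, a k * (n1 x ^ 2 * ind k x) := by
      intro x _
      have hG2 : Gam 4 L s (j + 1) x ^ 2 ≤ A ^ 2 := by
        rw [← sq_abs]; exact pow_le_pow_left₀ (abs_nonneg _) (hA x) 2
      calc n1 x ^ 2 * (|covSum 4 L s j x| * Gam 4 L s (j + 1) x ^ 2)
          = Gam 4 L s (j + 1) x ^ 2 * (n1 x ^ 2 * |covSum 4 L s j x|) := by ring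
        _ ≤ A ^ 2 * (n1 x ^ 2 * ∑ k ∈ Finset.range j, a k * ind k x) :=
            mul_le_mul hG2 (mul_le_mul_of_nonneg_left (hW x) (sq_nonneg _)) (by positivity) (sq_nonneg _)
        _ = A ^ 2 * ∑ k ∈ Finset.range j, a k * (n1 x ^ 2 * ind k x) := by
            rw [Finset.mul_sum]
            congr 1
            exact Finset.sum_congr rfl fun k _ => by ring
    refine (Finset.sum_le_sum hpt).trans ?_
    rw [← Finset.mul_sum, Finset.sum_comm]
    refine mul_le_mul_of_nonneg_left ?_ (sq_nonneg _)
    have hin : ∀ k, ∑ x ∈ S, a k * (n1 x ^ 2 * ind k x) ≤ 4 * c * L ^ 6 * L ^ (4 * k) := by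
      intro k
      rw [← Finset.mul_sum]
      calc a k * ∑ x ∈ S, n1 x ^ 2 * ind k x ≤ a k * (4 * L ^ 6 * L ^ (6 * k)) :=
            mul_le_mul_of_nonneg_left (sum_l1_sq_ind_le S hL1 k) (ha0 k)
        _ = 4 * c * L ^ 6 * (L ^ (6 * k) / L ^ (2 * k)) := by simp only [ha]; ring
        _ = 4 * c * L ^ 6 * L ^ (4 * k) := by rw [e64 k]
    refine (Finset.sum_le_sum fun k _ => hin k).trans ?_
    rw [← Finset.mul_sum]
    exact mul_le_mul_of_nonneg_left (geom_sum_four_le_pow hL j) (by positivity)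
  -- T3: `Σ_{x∈S} |x|₁² |C|³ ≤ A³ · 4L⁶L^{6j}`
  have hT3 : ∑ x ∈ S, n1 x ^ 2 * |Gam 4 L s (j + 1) x| ^ 3 ≤ A ^ 3 * (4 * L ^ 6 * L ^ (6 * j)) := by
    have hpt : ∀ x ∈ S, n1 x ^ 2 * |Gam 4 L s (j + 1) x| ^ 3 ≤ A ^ 3 * (n1 x ^ 2 * ind j x) := by
      intro x hx
      have hx' : ind j x = 1 := by simp only [hind]; rw [if_pos (by simpa [hSdef] using hx)]
      rw [hx', mul_one, mul_comm]
      exact mul_le_mul_of_nonneg_right (pow_le_pow_left₀ (abs_nonneg _) (hA x) 3) (sq_nonneg _)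
    refine (Finset.sum_le_sum hpt).trans ?_
    rw [← Finset.mul_sum]
    exact mul_le_mul_of_nonneg_left (sum_l1_sq_ind_le S hL1 j) (by positivity)
  -- pointwise assembly: `|x|₂²|w₊³ - w³| ≤ |x|₁²(3|C|w² + 3|w|C² + |C|³)`
  have hpt : ∀ x ∈ S, |(∑ i, ((x i : ℤ) : ℝ) ^ 2) * (covSum 4 L s (j + 1) x ^ 3 - covSum 4 L s j x ^ 3)| ≤
      3 * (n1 x ^ 2 * (|Gam 4 L s (j + 1) x| * covSum 4 L s j x ^ 2)) +
        3 * (n1 x ^ 2 * (|covSum 4 L s j x| * Gam 4 L s (j + 1) x ^ 2)) +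
        n1 x ^ 2 * |Gam 4 L s (j + 1) x| ^ 3 := by
    intro x _
    rw [covSum_succ]
    set G := Gam 4 L s (j + 1) x
    set W := covSum 4 L s j x
    have e : (W + G) ^ 3 - W ^ 3 = G * (3 * W ^ 2) + W * (3 * G ^ 2) + G ^ 3 := by ring
    rw [e, abs_mul, abs_of_nonneg (Finset.sum_nonneg fun i _ => sq_nonneg _)]
    have h2 : (∑ i, ((x i : ℤ) : ℝ) ^ 2) ≤ n1 x ^ 2 := sq_coords_le_l1_sq x
    have h3 : |G * (3 * W ^ 2) + W * (3 * G ^ 2) + G ^ 3| ≤ 3 * (|G| * W ^ 2) + 3 * (|W| * G ^ 2) + |G| ^ 3 := by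
      refine (abs_add_le _ _).trans (add_le_add ((abs_add_le _ _).trans (add_le_add ?_ ?_)) ?_)
      · rw [abs_mul, abs_of_nonneg (by positivity : (0 : ℝ) ≤ 3 * W ^ 2)]; linarith
      · rw [abs_mul, abs_of_nonneg (by positivity : (0 : ℝ) ≤ 3 * G ^ 2)]; linarith
      · rw [abs_pow]
    have h4 : 0 ≤ 3 * (|G| * W ^ 2) + 3 * (|W| * G ^ 2) + |G| ^ 3 := by positivity
    calc (∑ i, ((x i : ℤ) : ℝ) ^ 2) * |G * (3 * W ^ 2) + W * (3 * G ^ 2) + G ^ 3|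
        ≤ n1 x ^ 2 * (3 * (|G| * W ^ 2) + 3 * (|W| * G ^ 2) + |G| ^ 3) :=
          mul_le_mul h2 h3 (abs_nonneg _) (sq_nonneg _)
      _ = _ := by ring
  -- conclude
  rw [hθ, abs_mul, abs_of_pos (by norm_num : (0 : ℝ) < 1 / 2)]
  have hsum := (Finset.abs_sum_le_sum_abs _ _).trans (Finset.sum_le_sum hpt)
  rw [Finset.sum_add_distrib, Finset.sum_add_distrib, ← Finset.mul_sum, ← Finset.mul_sum] at hsum
  have htot : |∑ x ∈ S, (∑ i, ((x i : ℤ) : ℝ) ^ 2) * (covSum 4 L s (j + 1) x ^ 3 - covSum 4 L s j x ^ 3)| ≤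
      3 * (A * (4 * c ^ 2 * L ^ 6 * L ^ (2 * j))) + 3 * (A ^ 2 * (4 * c * L ^ 6 * L ^ (4 * j))) +
        A ^ 3 * (4 * L ^ 6 * L ^ (6 * j)) := by
    refine hsum.trans ?_
    gcongr
  refine (mul_le_mul_of_nonneg_left htot (by norm_num)).trans (le_of_eq ?_)
  have e4 : L ^ (4 * j) = (L ^ (2 * j)) ^ 2 := by rw [← pow_mul]; ring_nf
  have e6 : L ^ (6 * j) = (L ^ (2 * j)) ^ 3 := by rw [← pow_mul]; ring_nf
  rw [e4, e6]
  ring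

/-- **`|θ_j| ≤ 14c³L⁶`** for all `m² ≥ 0`, `j` (`d = 4`, `L ≥ 2`; `A = c/L^{2j}`, `t = c`).
[cite: BauerschmidtBrydgesSlade2015LogCorr, §6.1 (Assumption (A2) for θ_j; [BBS-rg-pt] Lemma 6.1.2: θ_j = O(1) at d = 4)] -/
theorem abs_thetaPT_le : ∃ K : ℝ, 0 < K ∧ ∀ L : ℝ, 2 ≤ L → ∀ s : ℝ, 0 ≤ s → ∀ j : ℕ,
    |thetaPT 4 L s j| ≤ K * L ^ 6 := by
  obtain ⟨c, hc, h⟩ := abs_Gam_four_le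
  refine ⟨14 * c ^ 3, by positivity, fun L hL s hs j => ?_⟩
  have hL0 : (0 : ℝ) < L := by linarith
  have hA0 : 0 ≤ c / L ^ (2 * j) := by positivity
  have := abs_thetaPT_le_core hc h hL hs j hA0 (fun x => h L hL s hs j x)
  have e : c / L ^ (2 * j) * L ^ (2 * j) = c := by field_simp
  rw [e] at this
  refine this.trans (le_of_eq ?_)
  ring

/-- **`|θ_j| ≤ KL⁶(1+L^{2j}m²/(8+m²))^{-p}`** for `m² > 0` (every `p`): `θ_j = O(χ_j)`.
[cite: BauerschmidtBrydgesSlade2015LogCorr, §6.1 (Assumption (A2): θ_j = O(χ_j); [BBS-rg-pt] Lemma 6.1.2: θ_j = O((1+m²L^{2j})^{-k}) at d = 4)] -/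
theorem abs_thetaPT_le_decay (p : ℕ) : ∃ K : ℝ, 0 < K ∧ ∀ L : ℝ, 2 ≤ L → ∀ s : ℝ, 0 < s → ∀ j : ℕ,
    |thetaPT 4 L s j| ≤ K * L ^ 6 * ((1 + L ^ (2 * j) * s / (8 + s)) ^ p)⁻¹ := by
  obtain ⟨c, hc, h⟩ := abs_Gam_four_le
  obtain ⟨c₁, hc₁, h₁⟩ := abs_Gam_four_le_decay p
  refine ⟨6 * c ^ 2 * c₁ + 6 * c * c₁ ^ 2 + 2 * c₁ ^ 3, by positivity, fun L hL s hs j => ?_⟩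
  have hL0 : (0 : ℝ) < L := by linarith
  set ϑ : ℝ := ((1 + L ^ (2 * j) * s / (8 + s)) ^ p)⁻¹ with hϑdef
  have hϑ0 : 0 < ϑ := by positivity
  have hϑ1 : ϑ ≤ 1 := by
    rw [hϑdef]
    refine inv_le_one_of_one_le₀ (one_le_pow₀ ?_)
    have : 0 ≤ L ^ (2 * j) * s / (8 + s) := by positivity
    linarith
  have hA0 : 0 ≤ c₁ * ϑ / L ^ (2 * j) := by positivity
  have := abs_thetaPT_le_core hc h hL hs.le j hA0 (fun x => h₁ L hL s hs j x)
  have e : c₁ * ϑ / L ^ (2 * j) * L ^ (2 * j) = c₁ * ϑ := by field_simp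
  rw [e] at this
  refine this.trans ?_
  have h2 : (c₁ * ϑ) ^ 2 ≤ c₁ ^ 2 * ϑ := by
    rw [mul_pow]
    exact mul_le_mul_of_nonneg_left (pow_le_of_le_one hϑ0.le hϑ1 two_ne_zero) (by positivity)
  have h3 : (c₁ * ϑ) ^ 3 ≤ c₁ ^ 3 * ϑ := by
    rw [mul_pow]
    exact mul_le_mul_of_nonneg_left (pow_le_of_le_one hϑ0.le hϑ1 three_ne_zero) (by positivity)
  have hL6 : 0 ≤ L ^ 6 := by positivity
  calc L ^ 6 * (6 * c ^ 2 * (c₁ * ϑ) + 6 * c * (c₁ * ϑ) ^ 2 + 2 * (c₁ * ϑ) ^ 3)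
      ≤ L ^ 6 * (6 * c ^ 2 * (c₁ * ϑ) + 6 * c * (c₁ ^ 2 * ϑ) + 2 * (c₁ ^ 3 * ϑ)) := by
        refine mul_le_mul_of_nonneg_left ?_ hL6
        nlinarith [mul_le_mul_of_nonneg_left h2 (by positivity : (0 : ℝ) ≤ 6 * c)]
    _ = (6 * c ^ 2 * c₁ + 6 * c * c₁ ^ 2 + 2 * c₁ ^ 3) * L ^ 6 * ϑ := by ring

end CTWSAW

end Literature.Barriers.CriticalPhenomena
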